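import Summits.QuantumFields.YangMills.Theorems.BalabanUVNodesN15TwoSpacingGluingRecordKnitRightRows
import HarnessLib

/-!
# THE GLUING STEP AT TWO LATTICE SPACINGS, LXI: THE ADJOINT REMAINDER ROWS OF THE COVER's LIFTED CUBES ON THE TORUS OF RECORD, BOTH SPACINGS, VOLUME FREE
# (dag-n15-c g14, FILE 103; N15 = NE2, s1 «background-layer OPERATOR ingredient»)

Cell `pub-ymgap`, seat `pub-ymgap-dag-n15-c` (R134 (a); HUMAN RULING D-0062), generation 14.  `bears_on: R4∕N15 · K3⁸ SpineGivenEndpointR13SepCoPHV (stmt-QuantumFields-27366)`.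
Filed `--supports stmt-QuantumFields-27366 --as helper` — COUNT-NEUTRAL.  Theorems only (0 `def`, 0 `sorry`).  Imports BY NAME FILE 102 `…RecordKnitRightRows` (★★ `hasMaj_cut_comp_commOp_deltaOp_of_products`,
§3 side-`S` supports; through it FILE 95 `rightRemainderConst_le` ∕ `maj₂_weaken`, FILE 73 `knitGR` ∕ `knitHR` ∕ `MP_eq_two_mul` ∕ `coverMargin_fit`, dag-n15-a `hasMaj_landauRe` and PROGRAMME P
`hasMaj_chiCube_liftCubeG(_fine)`, `hasMaj_chiCube_liftCubeG_sD_mulOp_pair`, `hasMaj_chiCube_liftCubeG_divAdj_mulOp_pair`, `mem_cubeW`); nothing in the tree is modified.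

WHAT.  `hasMaj_comp_mulOp_rescale` (a multiplier `a = r·g` behind a two-sided row costs `|r|`), ★★★ **`hasMaj_chiCube_knitGR_comp_commOp_deltaOp_pair`**: for odd `L ≥ 3`, `a > 0` there are `δ > 0`,
`Θ₀ ≥ 0` such that for every cube exponent `s`, volume exponent `m_T ≥ s + 1`, coarse scale `K ≥ 1`, refinement `r` and cube `□_k` of FILE 73's cover of the torus of record
`MP (paramsOf d L m_T K hL)` (`w = L^s`, `q = L^{m_T−s}`, side `L^{s+1}`; cubes `knitGR` = dag-n15-a's LIFTED Neumann propagators, partition `knitHR`):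
  `(M_{χ_k}G^{↑}(□_k))∘[Δ_a, M_{h_k}] ≤ 1_{□_k}(y)·(Θ₀∕L^s)·e^{−δ|y−y′|_T}`  at the coarse spacing `L^{−K}` AND at the fine spacing `L^{−(K+r)}`,
`δ, Θ₀` free of the volume `m_T`, of `s` and of the spacings — FILE 102 §2 fed with programme P's two-sided cut rows and PRODUCT right rows at the normalised coefficients `(L^s∕π)·∇^±h_k`
(`|·| ≤ 1`, supports FILE 102 §3), `Θ_w ≤ Θ₀∕w` by FILE 95 `rightRemainderConst_le`.  The record twin of FILE 94∕95's per-cube rows; CONSUMER: the record `R̃` rows and their defect (next files).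

HONEST FRAMING ∕ LIMITS.  Block-majorant bookkeeping over LANDED rows; `U ≡ 1` MODEL of [B6] §2's machine on the torus of record (cube letters from each cube's own doubled torus via
programme P: not circular in the volume); constants crude and ours; nothing of [B5]∕[B6] (2.38)–(2.40)∕[B9] Thm 3.1, 3.14 asserted.  NE2⁺ NOT PRINTED, NOT proved; N15 NOT discharged; counts of
record UNMOVED (typed 28∕28 · discharged 5∕27); one finite 𝕋⁴ at fixed ε per index — NOT infinite volume, NOT OS on ℝ⁴, NOT a mass gap, NOT Clay; R4 closes `BalabanLadder.UV` only.
Restate-immune (no Theses import).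
-/

noncomputable section

namespace Summit.QuantumFields.YangMills.BalabanUVNodes.N15.Gluing

open Literature.MathematicalPhysics.QuantumFieldTheory.Balaban1983to89
open Literature.MathematicalPhysics.QuantumFieldTheory.Balaban1983to89.B5Prop11Plancherel (Tor fine unitVec)
open Literature.MathematicalPhysics.QuantumFieldTheory.Balaban1983to89.B11SectG (BlockNorm HasMaj RowSum hasMaj_zero)
open Literature.MathematicalPhysics.QuantumFieldTheory.Balaban1983to89.B6Prop26Gluing (mulOp mulOp_apply ind ind_nonneg ind_le_one)
open Literature.MathematicalPhysics.QuantumFieldTheory.Balaban1983to89.T4EtaRateCoeffDefect (pull diagK hasMaj_mulOp)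
open Literature.MathematicalPhysics.QuantumFieldTheory.Balaban1983to89.B6UnitTorusCarrier (unitTorusGeo triangle254_unitTorusGeo rowSum_unitTorusGeo unitTorusGeo_dist_nonneg
  unitTorusGeo_dist_symm unitTorusGeo_dist_self)
open Literature.MathematicalPhysics.QuantumFieldTheory.Balaban1983to89.B5SiteBridgeP12 (MP)
open Literature.MathematicalPhysics.QuantumFieldTheory.King1986.Torus (blockOf tdistT tdistT_nonneg)
open Summit.QuantumFields.YangMills.BalabanUVNodes.N15.VectorPiece (bshiftEquiv bshiftEquiv_apply bshiftEquiv_symm_apply kingPrV blkFine)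
open Summit.QuantumFields.YangMills.BalabanUVNodes.N15.BackgroundLayer (fgrad fgradAdj bgrad fgrad_apply fgradAdj_apply bgrad_apply symbOp_sD_eq symbOp_sTinv_sub_one_eq)
open Summit.QuantumFields.YangMills.BalabanUVNodes.N15.TwoGrid (paramsOf deltaOp gOp symbOp sD sTinv chiCube cubeBlocks cubeW mem_cubeW landauRe qvRe qvAdjRe liftCubeG MP_dvd_MP
  hasMaj_smul_ofBlocks hasMaj_landauRe hasMaj_chiCube_liftCubeG hasMaj_chiCube_liftCubeG_fine hasMaj_chiCube_liftCubeG_sD_mulOp_pair hasMaj_chiCube_liftCubeG_divAdj_mulOp_pair)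

variable {d : ℕ}

/-! ## §4 ★★★ The adjoint remainder rows of the cover's LIFTED cubes on the torus of record, both spacings, volume free -/

section Record

open Real

variable {L : ℕ} [NeZero L]

/-- Rescaling a multiplier behind a two-sided row: `a = r·g` pointwise ⟹ the row of `T∘M_a` is `|r|` times the row of `T∘M_g`. [folklore] -/
theorem hasMaj_comp_mulOp_rescale {X : Type} [Fintype X] {g₀ : B6.Geometry} (blk : X → g₀.Site) {T : (X → ℝ) →ₗ[ℝ] (X → ℝ)} {S : Set g₀.Site} {a g : X → ℝ} {r c δ : ℝ}
    (hc : 0 ≤ c) (hag : ∀ x, a x = r * g x)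
    (hT : HasMaj (BlockNorm.ofBlocks g₀ blk) (BlockNorm.ofBlocks g₀ blk) (T ∘ₗ mulOp g) (fun y y' => ind S y * ind S y' * (c * Real.exp (-(δ * g₀.dist y y'))))) :
    HasMaj (BlockNorm.ofBlocks g₀ blk) (BlockNorm.ofBlocks g₀ blk) (T ∘ₗ mulOp a) (fun y y' => ind S y * ind S y' * (|r| * c * Real.exp (-(δ * g₀.dist y y')))) := by
  have e : T ∘ₗ mulOp a = r • (T ∘ₗ mulOp g) := by
    rw [← LinearMap.comp_smul]
    congr 1
    refine LinearMap.ext fun f => funext fun x => ?_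
    rw [LinearMap.smul_apply, Pi.smul_apply, mulOp_apply, mulOp_apply, hag x, smul_eq_mul, mul_assoc]
  rw [e]
  refine (hasMaj_smul_ofBlocks (g := g₀) blk (fun y y' => mul_nonneg (mul_nonneg (ind_nonneg _ _) (ind_nonneg _ _)) (mul_nonneg hc (Real.exp_nonneg _))) r hT).mono
    fun y y' => le_of_eq ?_
  ring

omit [NeZero L] in
/-- The FORWARD product right row of a lifted cut cube at the partition's coefficient `∇⁻_μh_k = (∇_μh_k)∘e_μ⁻¹`, from programme P's row at the normalised multiplier `(L^s∕π)·∇⁻_μh_k`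
(`|·| ≤ 1`, supported with its `μ`-predecessor in the window — FILE 102 §3). [cite: Balaban1984PropagatorsII, (2.36)–(2.37) p.229, (2.133)–(2.134) p.247 (shapes)] -/
theorem hasMaj_chiCube_knitGR_fgrad_mulOp (hL : Odd L ∧ 1 < L) (hL3 : 3 ≤ L) {a : ℝ} (s mT K n : ℕ) [NeZero n] (hs : s + 1 ≤ mT)
    (k : Fin (d + 1) → ZMod (2 * L ^ (mT - s))) {p δx : ℝ} (hp : 0 ≤ p) (μ : Fin (d + 1))
    (hD : ∀ (g : Tor (fine n (MP (paramsOf d L mT K hL))) × Fin (d + 1) → ℝ), (∀ b, |g b| ≤ 1) →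
      (∀ b, g b ≠ 0 → b ∈ cubeW n (coverCorner (MP (paramsOf d L mT K hL)) (L ^ s) (L ^ (mT - s)) (coverMargin L s) k) (L ^ (s + 1)) ∧ (b.1 - unitVec (fine n (MP (paramsOf d L mT K hL))) μ, b.2) ∈ cubeW n (coverCorner (MP (paramsOf d L mT K hL)) (L ^ s) (L ^ (mT - s)) (coverMargin L s) k) (L ^ (s + 1))) →
      HasMaj (BlockNorm.ofBlocks (unitTorusGeo L K (MP (paramsOf d L mT K hL))) (fun b : Tor (fine n (MP (paramsOf d L mT K hL))) × Fin (d + 1) => blockOf n (MP (paramsOf d L mT K hL)) b.1)) (BlockNorm.ofBlocks (unitTorusGeo L K (MP (paramsOf d L mT K hL))) (fun b : Tor (fine n (MP (paramsOf d L mT K hL))) × Fin (d + 1) => blockOf n (MP (paramsOf d L mT K hL)) b.1)) (mulOp (chiCube (MP (paramsOf d L mT K hL)) n (coverCorner (MP (paramsOf d L mT K hL)) (L ^ s) (L ^ (mT - s)) (coverMargin L s) k) (L ^ (s + 1))) ∘ₗ knitGR d L s mT K n hL hs a k ∘ₗ fgrad (n : ℝ) (bshiftEquiv (MP (paramsOf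 d L mT K hL)) n μ) ∘ₗ mulOp g)
        (fun y y' => ind ((cubeBlocks (MP (paramsOf d L mT K hL)) (coverCorner (MP (paramsOf d L mT K hL)) (L ^ s) (L ^ (mT - s)) (coverMargin L s) k) (L ^ (s + 1)) : Finset _) : Set _) y * ind ((cubeBlocks (MP (paramsOf d L mT K hL)) (coverCorner (MP (paramsOf d L mT K hL)) (L ^ s) (L ^ (mT - s)) (coverMargin L s) k) (L ^ (s + 1)) : Finset _) : Set _) y' * (p * Real.exp (-(δx * tdistT (MP (paramsOf d L mT K hL)) y y'))))) :
    HasMaj (BlockNorm.ofBlocks (unitTorusGeo L K (MP (paramsOf d L mT K hL))) (fun b : Tor (fine n (MP (paramsOf d L mT K hL))) × Fin (d + 1) => blockOf n (MP (paramsOf d L mT K hL)) b.1)) (BlockNorm.ofBlocks (unitTorusGeo L K (MP (paramsOf d L mT K hL))) (fun b : Tor (fine n (MP (paramsOf d L mT K hL))) × Fin (d + 1) => blockOf n (MP (paramsOf d L mT K hL)) b.1))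
      (((mulOp (chiCube (MP (paramsOf d L mT K hL)) n (coverCorner (MP (paramsOf d L mT K hL)) (L ^ s) (L ^ (mT - s)) (coverMargin L s) k) (L ^ (s + 1))) ∘ₗ knitGR d L s mT K n hL hs a k) ∘ₗ fgrad (n : ℝ) (bshiftEquiv (MP (paramsOf d L mT K hL)) n μ)) ∘ₗ
        mulOp (fgrad (n : ℝ) (bshiftEquiv (MP (paramsOf d L mT K hL)) n μ) (knitHR d L s mT K n hL k) ∘ ⇑(bshiftEquiv (MP (paramsOf d L mT K hL)) n μ).symm))
      (fun y y' => ind ((cubeBlocks (MP (paramsOf d L mT K hL)) (coverCorner (MP (paramsOf d L mT K hL)) (L ^ s) (L ^ (mT - s)) (coverMargin L s) k) (L ^ (s + 1)) : Finset _) : Set _) y * ind ((cubeBlocks (MP (paramsOf d L mT K hL)) (coverCorner (MP (paramsOf d L mT K hL)) (L ^ s) (L ^ (mT - s)) (coverMargin L s) k) (L ^ (s + 1)) : Finset _) : Set _) y' * (|π / ((L ^ s : ℕ) : ℝ)| * p * Real.exp (-(δx * tdistT (MP (paramsOf d L mT K hL)) y y')))) := by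
  have hLpos : 0 < L := by omega
  have hs' : s ≤ mT := by omega
  have hM : ∀ ν, MP (paramsOf d L mT K hL) ν = 2 * L ^ (mT - s) * L ^ s := MP_eq_two_mul L s mT K hL hs'
  have hw : 0 < L ^ s := pow_pos hLpos s
  have hfit := coverMargin_fit hL3 s
  have hSe : L ^ (s + 1) = L * L ^ s := by rw [pow_succ, mul_comm]
  have hfit1 : coverMargin L s + 2 * L ^ s + 1 ≤ L ^ (s + 1) := by rw [hSe]; omega
  have hS : L ^ (s + 1) ≤ 2 * L ^ (mT - s) * L ^ s := by
    calc L ^ (s + 1) ≤ L ^ mT := Nat.pow_le_pow_right hLpos hs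
      _ = L ^ (mT - s) * L ^ s := by rw [← pow_add]; congr 1; omega
      _ ≤ 2 * L ^ (mT - s) * L ^ s := by rw [mul_assoc]; omega
  have hwpos : (0 : ℝ) < ((L ^ s : ℕ) : ℝ) := by exact_mod_cast hw
  have hrr : ∀ t : ℝ, t = π / ((L ^ s : ℕ) : ℝ) * (((L ^ s : ℕ) : ℝ) / π * t) := fun t => by
    rw [← mul_assoc, show π / ((L ^ s : ℕ) : ℝ) * (((L ^ s : ℕ) : ℝ) / π) = 1 by field_simp, one_mul]
  have hg1 : ∀ b, |(((L ^ s : ℕ) : ℝ) / π) * (fgrad (n : ℝ) (bshiftEquiv (MP (paramsOf d L mT K hL)) n μ) (knitHR d L s mT K n hL k) ∘ ⇑(bshiftEquiv (MP (paramsOf d L mT K hL)) n μ).symm) b| ≤ 1 := by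
    intro b
    rw [abs_mul, abs_of_nonneg (by positivity : (0 : ℝ) ≤ ((L ^ s : ℕ) : ℝ) / π), fgrad_comp_symm_eq_bgrad]
    have h := abs_bgrad_coverH_le (n := n) hM hw k μ b
    calc ((L ^ s : ℕ) : ℝ) / π * |bgrad (n : ℝ) (bshiftEquiv (MP (paramsOf d L mT K hL)) n μ) (hcube (2 * L ^ (mT - s)) (coverXi (MP (paramsOf d L mT K hL)) n (L ^ s)) k) b|
        ≤ ((L ^ s : ℕ) : ℝ) / π * (π / ((L ^ s : ℕ) : ℝ)) := mul_le_mul_of_nonneg_left h (by positivity)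
      _ = 1 := by field_simp
  have hgs : ∀ b : Tor (fine n (MP (paramsOf d L mT K hL))) × Fin (d + 1), (((L ^ s : ℕ) : ℝ) / π) * (fgrad (n : ℝ) (bshiftEquiv (MP (paramsOf d L mT K hL)) n μ) (knitHR d L s mT K n hL k) ∘ ⇑(bshiftEquiv (MP (paramsOf d L mT K hL)) n μ).symm) b ≠ 0 →
      b ∈ cubeW n (coverCorner (MP (paramsOf d L mT K hL)) (L ^ s) (L ^ (mT - s)) (coverMargin L s) k) (L ^ (s + 1)) ∧ (b.1 - unitVec (fine n (MP (paramsOf d L mT K hL))) μ, b.2) ∈ cubeW n (coverCorner (MP (paramsOf d L mT K hL)) (L ^ s) (L ^ (mT - s)) (coverMargin L s) k) (L ^ (s + 1)) := by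
    intro b hb
    have h := bgrad_coverH_support_side (m₀ := coverMargin L s) hM hw hfit1 hS μ k b (right_ne_zero_of_mul hb)
    exact ⟨(mem_cubeW b).mpr h.1, (mem_cubeW _).mpr h.2⟩
  have hrow' : HasMaj (BlockNorm.ofBlocks (unitTorusGeo L K (MP (paramsOf d L mT K hL))) (fun b : Tor (fine n (MP (paramsOf d L mT K hL))) × Fin (d + 1) => blockOf n (MP (paramsOf d L mT K hL)) b.1)) (BlockNorm.ofBlocks (unitTorusGeo L K (MP (paramsOf d L mT K hL))) (fun b : Tor (fine n (MP (paramsOf d L mT K hL))) × Fin (d + 1) => blockOf n (MP (paramsOf d L mT K hL)) b.1))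
      (((mulOp (chiCube (MP (paramsOf d L mT K hL)) n (coverCorner (MP (paramsOf d L mT K hL)) (L ^ s) (L ^ (mT - s)) (coverMargin L s) k) (L ^ (s + 1))) ∘ₗ knitGR d L s mT K n hL hs a k) ∘ₗ fgrad (n : ℝ) (bshiftEquiv (MP (paramsOf d L mT K hL)) n μ)) ∘ₗ
        mulOp (fun b => (((L ^ s : ℕ) : ℝ) / π) * (fgrad (n : ℝ) (bshiftEquiv (MP (paramsOf d L mT K hL)) n μ) (knitHR d L s mT K n hL k) ∘ ⇑(bshiftEquiv (MP (paramsOf d L mT K hL)) n μ).symm) b))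
      (fun y y' => ind ((cubeBlocks (MP (paramsOf d L mT K hL)) (coverCorner (MP (paramsOf d L mT K hL)) (L ^ s) (L ^ (mT - s)) (coverMargin L s) k) (L ^ (s + 1)) : Finset _) : Set _) y * ind ((cubeBlocks (MP (paramsOf d L mT K hL)) (coverCorner (MP (paramsOf d L mT K hL)) (L ^ s) (L ^ (mT - s)) (coverMargin L s) k) (L ^ (s + 1)) : Finset _) : Set _) y' * (p * Real.exp (-(δx * tdistT (MP (paramsOf d L mT K hL)) y y')))) := (hD _ hg1 hgs).congr fun f => by simp only [LinearMap.comp_apply]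
  have h := hasMaj_comp_mulOp_rescale (g₀ := unitTorusGeo L K (MP (paramsOf d L mT K hL))) (fun b : Tor (fine n (MP (paramsOf d L mT K hL))) × Fin (d + 1) => blockOf n (MP (paramsOf d L mT K hL)) b.1) (T := (mulOp (chiCube (MP (paramsOf d L mT K hL)) n (coverCorner (MP (paramsOf d L mT K hL)) (L ^ s) (L ^ (mT - s)) (coverMargin L s) k) (L ^ (s + 1))) ∘ₗ knitGR d L s mT K n hL hs a k) ∘ₗ fgrad (n : ℝ) (bshiftEquiv (MP (paramsOf d L mT K hL)) n μ))
    (S := (((cubeBlocks (MP (paramsOf d L mT K hL)) (coverCorner (MP (paramsOf d L mT K hL)) (L ^ s) (L ^ (mT - s)) (coverMargin L s) k) (L ^ (s + 1)) : Finset _)) : Set _)) (r := π / ((L ^ s : ℕ) : ℝ)) (c := p) (δ := δx)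
    (a := fgrad (n : ℝ) (bshiftEquiv (MP (paramsOf d L mT K hL)) n μ) (knitHR d L s mT K n hL k) ∘ ⇑(bshiftEquiv (MP (paramsOf d L mT K hL)) n μ).symm)
    (g := fun b => (((L ^ s : ℕ) : ℝ) / π) * (fgrad (n : ℝ) (bshiftEquiv (MP (paramsOf d L mT K hL)) n μ) (knitHR d L s mT K n hL k) ∘ ⇑(bshiftEquiv (MP (paramsOf d L mT K hL)) n μ).symm) b)
    hp (fun b => hrr _) hrow'
  exact h


omit [NeZero L] in
/-- The BACKWARD product right row (`∇*_μ` with the coefficient `∇_μh_k = (∇⁻_μh_k)∘e_μ`), from programme P's `∇*`-row at the normalised multiplier `(L^s∕π)·∇_μh_k`.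
[cite: Balaban1984PropagatorsII, (2.36)–(2.37) p.229, (2.133)–(2.134) p.247 (shapes)] -/
theorem hasMaj_chiCube_knitGR_fgradAdj_mulOp (hL : Odd L ∧ 1 < L) (hL3 : 3 ≤ L) {a : ℝ} (s mT K n : ℕ) [NeZero n] (hs : s + 1 ≤ mT)
    (k : Fin (d + 1) → ZMod (2 * L ^ (mT - s))) {p δx : ℝ} (hp : 0 ≤ p) (μ : Fin (d + 1))
    (hBk : ∀ (g : Tor (fine n (MP (paramsOf d L mT K hL))) × Fin (d + 1) → ℝ), (∀ b, |g b| ≤ 1) →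
      (∀ b, g b ≠ 0 → b ∈ cubeW n (coverCorner (MP (paramsOf d L mT K hL)) (L ^ s) (L ^ (mT - s)) (coverMargin L s) k) (L ^ (s + 1)) ∧ (b.1 + unitVec (fine n (MP (paramsOf d L mT K hL))) μ, b.2) ∈ cubeW n (coverCorner (MP (paramsOf d L mT K hL)) (L ^ s) (L ^ (mT - s)) (coverMargin L s) k) (L ^ (s + 1))) →
      HasMaj (BlockNorm.ofBlocks (unitTorusGeo L K (MP (paramsOf d L mT K hL))) (fun b : Tor (fine n (MP (paramsOf d L mT K hL))) × Fin (d + 1) => blockOf n (MP (paramsOf d L mT K hL)) b.1)) (BlockNorm.ofBlocks (unitTorusGeo L K (MP (paramsOf d L mT K hL))) (fun b : Tor (fine n (MP (paramsOf d L mT K hL))) × Fin (d + 1) => blockOf n (MP (paramsOf d L mT K hL)) b.1)) (mulOp (chiCube (MP (paramsOf d L mT K hL)) n (coverCorner (MP (paramsOf d L mT K hL)) (L ^ s) (L ^ (mT - s)) (coverMargin L s) k) (L ^ (s + 1))) ∘ₗ knitGR d L s mT K n hL hs a k ∘ₗ fgradAdj (n : ℝ) (bshiftEquiv (MP (paramsOf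 d L mT K hL)) n μ) ∘ₗ mulOp g)
        (fun y y' => ind ((cubeBlocks (MP (paramsOf d L mT K hL)) (coverCorner (MP (paramsOf d L mT K hL)) (L ^ s) (L ^ (mT - s)) (coverMargin L s) k) (L ^ (s + 1)) : Finset _) : Set _) y * ind ((cubeBlocks (MP (paramsOf d L mT K hL)) (coverCorner (MP (paramsOf d L mT K hL)) (L ^ s) (L ^ (mT - s)) (coverMargin L s) k) (L ^ (s + 1)) : Finset _) : Set _) y' * (p * Real.exp (-(δx * tdistT (MP (paramsOf d L mT K hL)) y y'))))) :
    HasMaj (BlockNorm.ofBlocks (unitTorusGeo L K (MP (paramsOf d L mT K hL))) (fun b : Tor (fine n (MP (paramsOf d L mT K hL))) × Fin (d + 1) => blockOf n (MP (paramsOf d L mT K hL)) b.1)) (BlockNorm.ofBlocks (unitTorusGeo L K (MP (paramsOf d L mT K hL))) (fun b : Tor (fine n (MP (paramsOf d L mT K hL))) × Fin (d + 1) => blockOf n (MP (paramsOf d L mT K hL)) b.1))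
      (((mulOp (chiCube (MP (paramsOf d L mT K hL)) n (coverCorner (MP (paramsOf d L mT K hL)) (L ^ s) (L ^ (mT - s)) (coverMargin L s) k) (L ^ (s + 1))) ∘ₗ knitGR d L s mT K n hL hs a k) ∘ₗ fgradAdj (n : ℝ) (bshiftEquiv (MP (paramsOf d L mT K hL)) n μ)) ∘ₗ
        mulOp (bgrad (n : ℝ) (bshiftEquiv (MP (paramsOf d L mT K hL)) n μ) (knitHR d L s mT K n hL k) ∘ ⇑(bshiftEquiv (MP (paramsOf d L mT K hL)) n μ)))
      (fun y y' => ind ((cubeBlocks (MP (paramsOf d L mT K hL)) (coverCorner (MP (paramsOf d L mT K hL)) (L ^ s) (L ^ (mT - s)) (coverMargin L s) k) (L ^ (s + 1)) : Finset _) : Set _) y * ind ((cubeBlocks (MP (paramsOf d L mT K hL)) (coverCorner (MP (paramsOf d L mT K hL)) (L ^ s) (L ^ (mT - s)) (coverMargin L s) k) (L ^ (s + 1)) : Finset _) : Set _) y' * (|π / ((L ^ s : ℕ) : ℝ)| * p * Real.exp (-(δx * tdistT (MP (paramsOf d L mT K hL)) y y')))) := by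
  have hLpos : 0 < L := by omega
  have hs' : s ≤ mT := by omega
  have hM : ∀ ν, MP (paramsOf d L mT K hL) ν = 2 * L ^ (mT - s) * L ^ s := MP_eq_two_mul L s mT K hL hs'
  have hw : 0 < L ^ s := pow_pos hLpos s
  have hfit := coverMargin_fit hL3 s
  have hSe : L ^ (s + 1) = L * L ^ s := by rw [pow_succ, mul_comm]
  have hfit1 : coverMargin L s + 2 * L ^ s + 1 ≤ L ^ (s + 1) := by rw [hSe]; omega
  have hS : L ^ (s + 1) ≤ 2 * L ^ (mT - s) * L ^ s := by
    calc L ^ (s + 1) ≤ L ^ mT := Nat.pow_le_pow_right hLpos hs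
      _ = L ^ (mT - s) * L ^ s := by rw [← pow_add]; congr 1; omega
      _ ≤ 2 * L ^ (mT - s) * L ^ s := by rw [mul_assoc]; omega
  have hwpos : (0 : ℝ) < ((L ^ s : ℕ) : ℝ) := by exact_mod_cast hw
  have hrr : ∀ t : ℝ, t = π / ((L ^ s : ℕ) : ℝ) * (((L ^ s : ℕ) : ℝ) / π * t) := fun t => by
    rw [← mul_assoc, show π / ((L ^ s : ℕ) : ℝ) * (((L ^ s : ℕ) : ℝ) / π) = 1 by field_simp, one_mul]
  have hg1 : ∀ b, |(((L ^ s : ℕ) : ℝ) / π) * (bgrad (n : ℝ) (bshiftEquiv (MP (paramsOf d L mT K hL)) n μ) (knitHR d L s mT K n hL k) ∘ ⇑(bshiftEquiv (MP (paramsOf d L mT K hL)) n μ)) b| ≤ 1 := by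
    intro b
    rw [abs_mul, abs_of_nonneg (by positivity : (0 : ℝ) ≤ ((L ^ s : ℕ) : ℝ) / π), bgrad_comp_eq_fgrad]
    have h := abs_fgrad_coverH_le (n := n) hM hw k μ b
    calc ((L ^ s : ℕ) : ℝ) / π * |fgrad (n : ℝ) (bshiftEquiv (MP (paramsOf d L mT K hL)) n μ) (hcube (2 * L ^ (mT - s)) (coverXi (MP (paramsOf d L mT K hL)) n (L ^ s)) k) b|
        ≤ ((L ^ s : ℕ) : ℝ) / π * (π / ((L ^ s : ℕ) : ℝ)) := mul_le_mul_of_nonneg_left h (by positivity)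
      _ = 1 := by field_simp
  have hgs : ∀ b : Tor (fine n (MP (paramsOf d L mT K hL))) × Fin (d + 1), (((L ^ s : ℕ) : ℝ) / π) * (bgrad (n : ℝ) (bshiftEquiv (MP (paramsOf d L mT K hL)) n μ) (knitHR d L s mT K n hL k) ∘ ⇑(bshiftEquiv (MP (paramsOf d L mT K hL)) n μ)) b ≠ 0 →
      b ∈ cubeW n (coverCorner (MP (paramsOf d L mT K hL)) (L ^ s) (L ^ (mT - s)) (coverMargin L s) k) (L ^ (s + 1)) ∧ (b.1 + unitVec (fine n (MP (paramsOf d L mT K hL))) μ, b.2) ∈ cubeW n (coverCorner (MP (paramsOf d L mT K hL)) (L ^ s) (L ^ (mT - s)) (coverMargin L s) k) (L ^ (s + 1)) := by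
    intro b hb
    have h := fgrad_coverH_support_side (m₀ := coverMargin L s) hM hw hfit1 hS μ k b (right_ne_zero_of_mul hb)
    exact ⟨(mem_cubeW b).mpr h.1, (mem_cubeW _).mpr h.2⟩
  have hrow' : HasMaj (BlockNorm.ofBlocks (unitTorusGeo L K (MP (paramsOf d L mT K hL))) (fun b : Tor (fine n (MP (paramsOf d L mT K hL))) × Fin (d + 1) => blockOf n (MP (paramsOf d L mT K hL)) b.1)) (BlockNorm.ofBlocks (unitTorusGeo L K (MP (paramsOf d L mT K hL))) (fun b : Tor (fine n (MP (paramsOf d L mT K hL))) × Fin (d + 1) => blockOf n (MP (paramsOf d L mT K hL)) b.1))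
      (((mulOp (chiCube (MP (paramsOf d L mT K hL)) n (coverCorner (MP (paramsOf d L mT K hL)) (L ^ s) (L ^ (mT - s)) (coverMargin L s) k) (L ^ (s + 1))) ∘ₗ knitGR d L s mT K n hL hs a k) ∘ₗ fgradAdj (n : ℝ) (bshiftEquiv (MP (paramsOf d L mT K hL)) n μ)) ∘ₗ
        mulOp (fun b => (((L ^ s : ℕ) : ℝ) / π) * (bgrad (n : ℝ) (bshiftEquiv (MP (paramsOf d L mT K hL)) n μ) (knitHR d L s mT K n hL k) ∘ ⇑(bshiftEquiv (MP (paramsOf d L mT K hL)) n μ)) b))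
      (fun y y' => ind ((cubeBlocks (MP (paramsOf d L mT K hL)) (coverCorner (MP (paramsOf d L mT K hL)) (L ^ s) (L ^ (mT - s)) (coverMargin L s) k) (L ^ (s + 1)) : Finset _) : Set _) y * ind ((cubeBlocks (MP (paramsOf d L mT K hL)) (coverCorner (MP (paramsOf d L mT K hL)) (L ^ s) (L ^ (mT - s)) (coverMargin L s) k) (L ^ (s + 1)) : Finset _) : Set _) y' * (p * Real.exp (-(δx * tdistT (MP (paramsOf d L mT K hL)) y y')))) := (hBk _ hg1 hgs).congr fun f => by simp only [LinearMap.comp_apply]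
  have h := hasMaj_comp_mulOp_rescale (g₀ := unitTorusGeo L K (MP (paramsOf d L mT K hL))) (fun b : Tor (fine n (MP (paramsOf d L mT K hL))) × Fin (d + 1) => blockOf n (MP (paramsOf d L mT K hL)) b.1) (T := (mulOp (chiCube (MP (paramsOf d L mT K hL)) n (coverCorner (MP (paramsOf d L mT K hL)) (L ^ s) (L ^ (mT - s)) (coverMargin L s) k) (L ^ (s + 1))) ∘ₗ knitGR d L s mT K n hL hs a k) ∘ₗ fgradAdj (n : ℝ) (bshiftEquiv (MP (paramsOf d L mT K hL)) n μ))
    (S := (((cubeBlocks (MP (paramsOf d L mT K hL)) (coverCorner (MP (paramsOf d L mT K hL)) (L ^ s) (L ^ (mT - s)) (coverMargin L s) k) (L ^ (s + 1)) : Finset _)) : Set _)) (r := π / ((L ^ s : ℕ) : ℝ)) (c := p) (δ := δx)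
    (a := bgrad (n : ℝ) (bshiftEquiv (MP (paramsOf d L mT K hL)) n μ) (knitHR d L s mT K n hL k) ∘ ⇑(bshiftEquiv (MP (paramsOf d L mT K hL)) n μ))
    (g := fun b => (((L ^ s : ℕ) : ℝ) / π) * (bgrad (n : ℝ) (bshiftEquiv (MP (paramsOf d L mT K hL)) n μ) (knitHR d L s mT K n hL k) ∘ ⇑(bshiftEquiv (MP (paramsOf d L mT K hL)) n μ)) b)
    hp (fun b => hrr _) hrow'
  exact h


omit [NeZero L] in
/-- ★★ **ONE LIFTED CUBE, ONE SPACING**: on the torus of record with FILE 73's cover, the adjoint remainder row of the cut lifted cube `□_k` at spacing `n` from a two-sided cut row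
(`βc, δx`), programme P's product right rows for all normalised multipliers supported with their `∓e_ν`-translates in the window (`p, δx`), and the `∂Π∂*` letter (`C₁, δ₁`) — FILE 102 §2 at
`q = L^{m_T−s}`, `w = L^s`, `S = L^{s+1}` with the coefficients `∇^±h_k = (π∕L^s)·g^±`, `|g^±| ≤ 1` (FILE 67's letters, FILE 102 §3's supports). [cite: Balaban1984PropagatorsII, (2.133)–(2.135) p.247
(shapes + mechanism, transposed); Balaban1984PropagatorsI, (1.126)–(1.128) p.38] -/
theorem hasMaj_chiCube_knitGR_comp_commOp_deltaOp_of (hL : Odd L ∧ 1 < L) (hL3 : 3 ≤ L) {a : ℝ} (s mT K n : ℕ) [NeZero n] (hs : s + 1 ≤ mT)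
    (k : Fin (d + 1) → ZMod (2 * L ^ (mT - s))) {βc p δx C₁ δ₁ : ℝ} (hβc : 0 ≤ βc) (hp : 0 ≤ p) (hδx : 0 < δx) (hC₁ : 0 ≤ C₁) (hδ₁ : 0 < δ₁)
    (hGc : HasMaj (BlockNorm.ofBlocks (unitTorusGeo L K (MP (paramsOf d L mT K hL))) (fun b : Tor (fine n (MP (paramsOf d L mT K hL))) × Fin (d + 1) => blockOf n (MP (paramsOf d L mT K hL)) b.1)) (BlockNorm.ofBlocks (unitTorusGeo L K (MP (paramsOf d L mT K hL))) (fun b : Tor (fine n (MP (paramsOf d L mT K hL))) × Fin (d + 1) => blockOf n (MP (paramsOf d L mT K hL)) b.1)) (mulOp (chiCube (MP (paramsOf d L mT K hL)) n (coverCorner (MP (paramsOf d L mT K hL)) (L ^ s) (L ^ (mT - s)) (coverMargin L s) k) (L ^ (s + 1))) ∘ₗ knitGR d L s mT K n hL hs a k)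
      (fun y y' => ind ((cubeBlocks (MP (paramsOf d L mT K hL)) (coverCorner (MP (paramsOf d L mT K hL)) (L ^ s) (L ^ (mT - s)) (coverMargin L s) k) (L ^ (s + 1)) : Finset _) : Set _) y * ind ((cubeBlocks (MP (paramsOf d L mT K hL)) (coverCorner (MP (paramsOf d L mT K hL)) (L ^ s) (L ^ (mT - s)) (coverMargin L s) k) (L ^ (s + 1)) : Finset _) : Set _) y' * (βc * Real.exp (-(δx * tdistT (MP (paramsOf d L mT K hL)) y y')))))
    (hD : ∀ (ν : Fin (d + 1)) (g : Tor (fine n (MP (paramsOf d L mT K hL))) × Fin (d + 1) → ℝ), (∀ b, |g b| ≤ 1) →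
      (∀ b, g b ≠ 0 → b ∈ cubeW n (coverCorner (MP (paramsOf d L mT K hL)) (L ^ s) (L ^ (mT - s)) (coverMargin L s) k) (L ^ (s + 1)) ∧ (b.1 - unitVec (fine n (MP (paramsOf d L mT K hL))) ν, b.2) ∈ cubeW n (coverCorner (MP (paramsOf d L mT K hL)) (L ^ s) (L ^ (mT - s)) (coverMargin L s) k) (L ^ (s + 1))) →
      HasMaj (BlockNorm.ofBlocks (unitTorusGeo L K (MP (paramsOf d L mT K hL))) (fun b : Tor (fine n (MP (paramsOf d L mT K hL))) × Fin (d + 1) => blockOf n (MP (paramsOf d L mT K hL)) b.1)) (BlockNorm.ofBlocks (unitTorusGeo L K (MP (paramsOf d L mT K hL))) (fun b : Tor (fine n (MP (paramsOf d L mT K hL))) × Fin (d + 1) => blockOf n (MP (paramsOf d L mT K hL)) b.1)) (mulOp (chiCube (MP (paramsOf d L mT K hL)) n (coverCorner (MP (paramsOf d L mT K hL)) (L ^ s) (L ^ (mT - s)) (coverMargin L s) k) (L ^ (s + 1))) ∘ₗ knitGR d L s mT K n hL hs a k ∘ₗ fgrad (n : ℝ) (bshiftEquiv (MP (paramsOf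 d L mT K hL)) n ν) ∘ₗ mulOp g)
        (fun y y' => ind ((cubeBlocks (MP (paramsOf d L mT K hL)) (coverCorner (MP (paramsOf d L mT K hL)) (L ^ s) (L ^ (mT - s)) (coverMargin L s) k) (L ^ (s + 1)) : Finset _) : Set _) y * ind ((cubeBlocks (MP (paramsOf d L mT K hL)) (coverCorner (MP (paramsOf d L mT K hL)) (L ^ s) (L ^ (mT - s)) (coverMargin L s) k) (L ^ (s + 1)) : Finset _) : Set _) y' * (p * Real.exp (-(δx * tdistT (MP (paramsOf d L mT K hL)) y y')))))
    (hBk : ∀ (ν : Fin (d + 1)) (g : Tor (fine n (MP (paramsOf d L mT K hL))) × Fin (d + 1) → ℝ), (∀ b, |g b| ≤ 1) →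
      (∀ b, g b ≠ 0 → b ∈ cubeW n (coverCorner (MP (paramsOf d L mT K hL)) (L ^ s) (L ^ (mT - s)) (coverMargin L s) k) (L ^ (s + 1)) ∧ (b.1 + unitVec (fine n (MP (paramsOf d L mT K hL))) ν, b.2) ∈ cubeW n (coverCorner (MP (paramsOf d L mT K hL)) (L ^ s) (L ^ (mT - s)) (coverMargin L s) k) (L ^ (s + 1))) →
      HasMaj (BlockNorm.ofBlocks (unitTorusGeo L K (MP (paramsOf d L mT K hL))) (fun b : Tor (fine n (MP (paramsOf d L mT K hL))) × Fin (d + 1) => blockOf n (MP (paramsOf d L mT K hL)) b.1)) (BlockNorm.ofBlocks (unitTorusGeo L K (MP (paramsOf d L mT K hL))) (fun b : Tor (fine n (MP (paramsOf d L mT K hL))) × Fin (d + 1) => blockOf n (MP (paramsOf d L mT K hL)) b.1)) (mulOp (chiCube (MP (paramsOf d L mT K hL)) n (coverCorner (MP (paramsOf d L mT K hL)) (L ^ s) (L ^ (mT - s)) (coverMargin L s) k) (L ^ (s + 1))) ∘ₗ knitGR d L s mT K n hL hs a k ∘ₗ fgradAdj (n : ℝ) (bshiftEquiv (MP (paramsOf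 d L mT K hL)) n ν) ∘ₗ mulOp g)
        (fun y y' => ind ((cubeBlocks (MP (paramsOf d L mT K hL)) (coverCorner (MP (paramsOf d L mT K hL)) (L ^ s) (L ^ (mT - s)) (coverMargin L s) k) (L ^ (s + 1)) : Finset _) : Set _) y * ind ((cubeBlocks (MP (paramsOf d L mT K hL)) (coverCorner (MP (paramsOf d L mT K hL)) (L ^ s) (L ^ (mT - s)) (coverMargin L s) k) (L ^ (s + 1)) : Finset _) : Set _) y' * (p * Real.exp (-(δx * tdistT (MP (paramsOf d L mT K hL)) y y')))))
    (hNL : HasMaj (BlockNorm.ofBlocks (unitTorusGeo L K (MP (paramsOf d L mT K hL))) (fun b : Tor (fine n (MP (paramsOf d L mT K hL))) × Fin (d + 1) => blockOf n (MP (paramsOf d L mT K hL)) b.1)) (BlockNorm.ofBlocks (unitTorusGeo L K (MP (paramsOf d L mT K hL))) (fun b : Tor (fine n (MP (paramsOf d L mT K hL))) × Fin (d + 1) => blockOf n (MP (paramsOf d L mT K hL)) b.1)) (landauRe (MP (paramsOf d L mT K hL)) n) (fun y y' => C₁ * Real.exp (-(δ₁ * tdistT (MP (paramsOf d L mT K hL))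 y y')))) :
    HasMaj (BlockNorm.ofBlocks (unitTorusGeo L K (MP (paramsOf d L mT K hL))) (fun b : Tor (fine n (MP (paramsOf d L mT K hL))) × Fin (d + 1) => blockOf n (MP (paramsOf d L mT K hL)) b.1)) (BlockNorm.ofBlocks (unitTorusGeo L K (MP (paramsOf d L mT K hL))) (fun b : Tor (fine n (MP (paramsOf d L mT K hL))) × Fin (d + 1) => blockOf n (MP (paramsOf d L mT K hL)) b.1)) ((mulOp (chiCube (MP (paramsOf d L mT K hL)) n (coverCorner (MP (paramsOf d L mT K hL)) (L ^ s) (L ^ (mT - s)) (coverMargin L s) k) (L ^ (s + 1))) ∘ₗ knitGR d L s mT K n hL hs a k) ∘ₗ commOp (deltaOp (MP (paramsOf d L mT K hL)) n a) (knitHR d L s mT K n hL k))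
      (fun y y' => ind ((cubeBlocks (MP (paramsOf d L mT K hL)) (coverCorner (MP (paramsOf d L mT K hL)) (L ^ s) (L ^ (mT - s)) (coverMargin L s) k) (L ^ (s + 1)) : Finset _) : Set _) y *
        ((((d + 1 : ℕ) : ℝ) * (3 * (βc * (32 * π ^ 2 / (((L ^ s : ℕ) : ℝ)) ^ 2)) + 2 * (π / ((L ^ s : ℕ) : ℝ) * p)) + 0 +
            βc * ((π * (d + 1) / ((L ^ s : ℕ) : ℝ) * (Real.exp 1 * (min δx δ₁ / 4))⁻¹ + 2 * (π * (d + 1) / ((L ^ s : ℕ) : ℝ))) *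
              (|a| * (Real.exp (min δx δ₁) * Real.exp (min δx δ₁)) + C₁)) * B4Sect5Proof.latticeConst (d + 1) (min δx δ₁ / 4)) *
          Real.exp (-(min δx δ₁ / 2 * tdistT (MP (paramsOf d L mT K hL)) y y')))) := by
  have hLpos : 0 < L := by omega
  have hs' : s ≤ mT := by omega
  have hM : ∀ ν, MP (paramsOf d L mT K hL) ν = 2 * L ^ (mT - s) * L ^ s := MP_eq_two_mul L s mT K hL hs'
  have hw : 0 < L ^ s := pow_pos hLpos s
  have habs : |π / ((L ^ s : ℕ) : ℝ)| = π / ((L ^ s : ℕ) : ℝ) := abs_of_nonneg (by positivity)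
  -- the product rows at the partition's coefficients (normalised by `L^s∕π`)
  -- the product rows at the partition's coefficients (normalised by `L^s∕π`)
  have hPD := fun μ => hasMaj_chiCube_knitGR_fgrad_mulOp (d := d) hL hL3 (a := a) s mT K n hs k hp μ (hD μ)
  have hPB := fun μ => hasMaj_chiCube_knitGR_fgradAdj_mulOp (d := d) hL hL3 (a := a) s mT K n hs k hp μ (hBk μ)
  have hc := hasMaj_cut_comp_commOp_deltaOp_of_products (L := L) (kk := K) (n := n) (q := L ^ (mT - s)) (w := L ^ s) (m₀ := coverMargin L s) (S := L ^ (s + 1)) hM hw k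
    (a := a) hβc hδx hC₁ hδ₁ (by positivity : 0 ≤ |π / ((L ^ s : ℕ) : ℝ)| * p) hGc hPD hPB hNL
  rw [habs] at hc
  exact hc

/-- ★★★ **THE ADJOINT REMAINDER ROWS OF THE COVER's LIFTED CUBES ON THE TORUS OF RECORD, BOTH SPACINGS, VOLUME FREE.**  For odd `L ≥ 3`, `a > 0` there are `δ > 0`, `Θ₀ ≥ 0` such that for
every cube exponent `s`, volume exponent `m_T ≥ s + 1`, coarse scale `K ≥ 1`, refinement `r` and cube `□_k` of FILE 73's cover of `MP (paramsOf d L m_T K hL)` (`w = L^s`, `q = L^{m_T−s}`, side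
`L^{s+1}`, cubes `knitGR` = dag-n15-a's lifted Neumann propagators, partition `knitHR`):
  `(M_{χ_k}G^{↑}(□_k))∘[Δ_a, M_{h_k}] ≤ 1_{□_k}(y)·(Θ₀∕L^s)·e^{−δ|y−y′|_T}`  at the coarse spacing `L^{−K}` AND at the fine spacing `L^{−(K+r)}`
— §2 fed with programme P's rows: the two-sided cut rows `hasMaj_chiCube_liftCubeG(_fine)`, the product right rows `hasMaj_chiCube_liftCubeG_sD_mulOp_pair` ∕ `…_divAdj_mulOp_pair` at the
normalised coefficients `(w∕π)·∇^±h_k` (supports §3), and `hasMaj_landauRe`; `Θ_w ≤ Θ₀∕w` by FILE 95 `rightRemainderConst_le`.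
[cite: Balaban1984PropagatorsII, (2.37) p.229, (2.91)–(2.93) p.239, (2.133)–(2.135) p.247 (shapes + mechanism, transposed); Balaban1984PropagatorsI, Prop. 1.2 (1.110) p.35, (1.126) p.38] -/
theorem hasMaj_chiCube_knitGR_comp_commOp_deltaOp_pair (hL : Odd L ∧ 1 < L) {a : ℝ} (ha : 0 < a) :
    ∃ δ Θ₀ : ℝ, 0 < δ ∧ 0 ≤ Θ₀ ∧ ∀ (s mT K r : ℕ) (hs : s + 1 ≤ mT) (_hK : 1 ≤ K) (k : Fin (d + 1) → ZMod (2 * L ^ (mT - s))),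
      HasMaj (BlockNorm.ofBlocks (unitTorusGeo L K (MP (paramsOf d L mT K hL)))
          (fun b : Tor (fine (L ^ K) (MP (paramsOf d L mT K hL))) × Fin (d + 1) => blockOf (L ^ K) (MP (paramsOf d L mT K hL)) b.1))
        (BlockNorm.ofBlocks (unitTorusGeo L K (MP (paramsOf d L mT K hL)))
          (fun b : Tor (fine (L ^ K) (MP (paramsOf d L mT K hL))) × Fin (d + 1) => blockOf (L ^ K) (MP (paramsOf d L mT K hL)) b.1))
        ((mulOp (chiCube (MP (paramsOf d L mT K hL)) (L ^ K) (coverCorner (MP (paramsOf d L mT K hL)) (L ^ s) (L ^ (mT - s)) (coverMargin L s) k) (L ^ (s + 1))) ∘ₗ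
            knitGR d L s mT K (L ^ K) hL hs a k) ∘ₗ
          commOp (deltaOp (MP (paramsOf d L mT K hL)) (L ^ K) a) (knitHR d L s mT K (L ^ K) hL k))
        (fun y y' => ind ((cubeBlocks (MP (paramsOf d L mT K hL)) (coverCorner (MP (paramsOf d L mT K hL)) (L ^ s) (L ^ (mT - s)) (coverMargin L s) k) (L ^ (s + 1)) : Finset _) : Set _) y *
          (Θ₀ / (L : ℝ) ^ s * Real.exp (-(δ * tdistT (MP (paramsOf d L mT K hL)) y y')))) ∧
      HasMaj (BlockNorm.ofBlocks (unitTorusGeo L K (MP (paramsOf d L mT K hL)))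
          (fun x : Tor (fine (L ^ r * L ^ K) (MP (paramsOf d L mT K hL))) × Fin (d + 1) => blockOf (L ^ r * L ^ K) (MP (paramsOf d L mT K hL)) x.1))
        (BlockNorm.ofBlocks (unitTorusGeo L K (MP (paramsOf d L mT K hL)))
          (fun x : Tor (fine (L ^ r * L ^ K) (MP (paramsOf d L mT K hL))) × Fin (d + 1) => blockOf (L ^ r * L ^ K) (MP (paramsOf d L mT K hL)) x.1))
        ((mulOp (chiCube (MP (paramsOf d L mT K hL)) (L ^ r * L ^ K) (coverCorner (MP (paramsOf d L mT K hL)) (L ^ s) (L ^ (mT - s)) (coverMargin L s) k) (L ^ (s + 1))) ∘ₗ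
            knitGR d L s mT K (L ^ r * L ^ K) hL hs a k) ∘ₗ
          commOp (deltaOp (MP (paramsOf d L mT K hL)) (L ^ r * L ^ K) a) (knitHR d L s mT K (L ^ r * L ^ K) hL k))
        (fun y y' => ind ((cubeBlocks (MP (paramsOf d L mT K hL)) (coverCorner (MP (paramsOf d L mT K hL)) (L ^ s) (L ^ (mT - s)) (coverMargin L s) k) (L ^ (s + 1)) : Finset _) : Set _) y *
          (Θ₀ / (L : ℝ) ^ s * Real.exp (-(δ * tdistT (MP (paramsOf d L mT K hL)) y y')))) := by
  have hL3 : 3 ≤ L := by obtain ⟨⟨j, hj⟩, h1⟩ := hL; omega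
  have hLpos : 0 < L := by omega
  -- programme P's rows and the Landau letter, all free of the volume
  obtain ⟨δG, βG, hδG, hβG, HG⟩ := hasMaj_chiCube_liftCubeG (d := d) hL ha
  obtain ⟨δG', βG', hδG', hβG', HG'⟩ := hasMaj_chiCube_liftCubeG_fine (d := d) hL ha
  obtain ⟨δD, βD, hδD, hβD, HD⟩ := hasMaj_chiCube_liftCubeG_sD_mulOp_pair (d := d) hL ha
  obtain ⟨δB, βB, hδB, hβB, HB⟩ := hasMaj_chiCube_liftCubeG_divAdj_mulOp_pair (d := d) hL ha
  obtain ⟨δ₁, C₁, hδ₁, hC₁, HL⟩ := hasMaj_landauRe (d := d) (L := L)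
  -- one rate, one cut constant, one product constant
  obtain ⟨δx, hδx_def⟩ : ∃ δx : ℝ, δx = min (min δG δG') (min δD δB) := ⟨_, rfl⟩
  have hδx : 0 < δx := hδx_def ▸ lt_min (lt_min hδG hδG') (lt_min hδD hδB)
  have dG : δx ≤ δG := hδx_def ▸ (min_le_left _ _).trans (min_le_left _ _)
  have dG' : δx ≤ δG' := hδx_def ▸ (min_le_left _ _).trans (min_le_right _ _)
  have dD : δx ≤ δD := hδx_def ▸ (min_le_right _ _).trans (min_le_left _ _)
  have dB : δx ≤ δB := hδx_def ▸ (min_le_right _ _).trans (min_le_right _ _)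
  have hβ : 0 ≤ (βG + βG') := by positivity
  have hP : 0 ≤ 2 * (βD * Real.exp δD) + βB * 1 := by positivity
  have hPD' : 2 * (βD * Real.exp δD) ≤ 2 * (βD * Real.exp δD) + βB * 1 := by nlinarith [hβB.le]
  have hPB' : βB * 1 ≤ 2 * (βD * Real.exp δD) + βB * 1 := by nlinarith [hβD.le, Real.exp_pos δD]
  have hδm : 0 < min δx δ₁ := lt_min hδx hδ₁
  have hcr : 0 ≤ B4Sect5Proof.latticeConst (d + 1) (min δx δ₁ / 4) := B4Sect5Proof.latticeConst_nonneg (d + 1) (by positivity)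
  refine ⟨min δx δ₁ / 2,
    (((d + 1 : ℕ) : ℝ) * (3 * ((βG + βG') * (32 * π ^ 2)) + 2 * ((2 * (βD * Real.exp δD) + βB * 1) * π)) +
      (βG + βG') * ((π * ((d : ℝ) + 1) * (Real.exp 1 * (min δx δ₁ / 4))⁻¹ + 2 * (π * ((d : ℝ) + 1))) * (|a| * (Real.exp (min δx δ₁) * Real.exp (min δx δ₁)) + C₁)) *
        B4Sect5Proof.latticeConst (d + 1) (min δx δ₁ / 4)),
    by positivity, by positivity, fun s mT K r hs hK k => ?_⟩
  have hw : 0 < L ^ s := pow_pos hLpos s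
  have hwR : (1 : ℝ) ≤ ((L ^ s : ℕ) : ℝ) := by exact_mod_cast hw
  have hwcast : ((L ^ s : ℕ) : ℝ) = (L : ℝ) ^ s := Nat.cast_pow L s
  have hΘ := rightRemainderConst_le (D := ((d + 1 : ℕ) : ℝ)) (Dr := (d : ℝ) + 1) (β := (βG + βG')) (β₁ := 2 * (βD * Real.exp δD) + βB * 1)
    (cN := |a| * (Real.exp (min δx δ₁) * Real.exp (min δx δ₁)) + C₁) (cr := B4Sect5Proof.latticeConst (d + 1) (min δx δ₁ / 4)) (E := Real.exp 1 * (min δx δ₁ / 4)) hwR (by positivity) hβ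
  have key : ((d + 1 : ℕ) : ℝ) * (3 * ((βG + βG') * (32 * π ^ 2 / (((L ^ s : ℕ) : ℝ)) ^ 2)) + 2 * (π / ((L ^ s : ℕ) : ℝ) * (2 * (βD * Real.exp δD) + βB * 1))) + 0 +
      (βG + βG') * ((π * (d + 1) / ((L ^ s : ℕ) : ℝ) * (Real.exp 1 * (min δx δ₁ / 4))⁻¹ + 2 * (π * (d + 1) / ((L ^ s : ℕ) : ℝ))) *
        (|a| * (Real.exp (min δx δ₁) * Real.exp (min δx δ₁)) + C₁)) * B4Sect5Proof.latticeConst (d + 1) (min δx δ₁ / 4) ≤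
      (((d + 1 : ℕ) : ℝ) * (3 * ((βG + βG') * (32 * π ^ 2)) + 2 * ((2 * (βD * Real.exp δD) + βB * 1) * π)) +
        (βG + βG') * ((π * ((d : ℝ) + 1) * (Real.exp 1 * (min δx δ₁ / 4))⁻¹ + 2 * (π * ((d : ℝ) + 1))) * (|a| * (Real.exp (min δx δ₁) * Real.exp (min δx δ₁)) + C₁)) *
          B4Sect5Proof.latticeConst (d + 1) (min δx δ₁ / 4)) / ((L ^ s : ℕ) : ℝ) := by
    have e : 2 * (π / ((L ^ s : ℕ) : ℝ) * (2 * (βD * Real.exp δD) + βB * 1)) = 2 * ((2 * (βD * Real.exp δD) + βB * 1) * (π / ((L ^ s : ℕ) : ℝ))) := by ring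
    rw [e]
    exact hΘ
  have zabs : ∀ {Y : Type} (b : Y), |(0 : Y → ℝ) b| ≤ 1 := fun b => by simp
  constructor
  · refine (hasMaj_chiCube_knitGR_comp_commOp_deltaOp_of (d := d) hL hL3 s mT K (L ^ K) hs k hβ hP hδx hC₁.le hδ₁ ?_ ?_ ?_ (HL K (L ^ K) _)).mono fun y y' =>
      mul_le_mul_of_nonneg_left ?_ (ind_nonneg _ _)
    · exact (HG (s + 1) mT K hs hK (coverCorner (MP (paramsOf d L mT K hL)) (L ^ s) (L ^ (mT - s)) (coverMargin L s) k)).mono fun y y' => maj₂_weaken (by linarith [hβG'.le] : βG ≤ βG + βG') hβ dG y y'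
    · intro ν g hg1 hgs
      have h := (HD (s + 1) mT K 0 hs hK (coverCorner (MP (paramsOf d L mT K hL)) (L ^ s) (L ^ (mT - s)) (coverMargin L s) k) ν g 0 hg1 hgs zabs (fun b hb => absurd rfl hb)).1
      rw [symbOp_sD_eq] at h
      exact h.mono fun y y' => maj₂_weaken hPD' hP dD y y'
    · intro ν g hg1 hgs
      have h := (HB (s + 1) mT K 0 hs hK (coverCorner (MP (paramsOf d L mT K hL)) (L ^ s) (L ^ (mT - s)) (coverMargin L s) k) ν g 0 hg1 hgs zabs (fun b hb => absurd rfl hb)).1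
      rw [symbOp_sTinv_sub_one_eq] at h
      exact h.mono fun y y' => maj₂_weaken hPB' hP dB y y'
    · rw [← hwcast]
      exact mul_le_mul_of_nonneg_right key (Real.exp_nonneg _)
  · refine (hasMaj_chiCube_knitGR_comp_commOp_deltaOp_of (d := d) hL hL3 s mT K (L ^ r * L ^ K) hs k hβ hP hδx hC₁.le hδ₁ ?_ ?_ ?_ (HL K (L ^ r * L ^ K) _)).mono fun y y' =>
      mul_le_mul_of_nonneg_left ?_ (ind_nonneg _ _)
    · exact (HG' (s + 1) mT K r hs hK (coverCorner (MP (paramsOf d L mT K hL)) (L ^ s) (L ^ (mT - s)) (coverMargin L s) k)).mono fun y y' => maj₂_weaken (by linarith [hβG.le] : βG' ≤ βG + βG') hβ dG' y y'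
    · intro ν g hg1 hgs
      have h := (HD (s + 1) mT K r hs hK (coverCorner (MP (paramsOf d L mT K hL)) (L ^ s) (L ^ (mT - s)) (coverMargin L s) k) ν 0 g zabs (fun b hb => absurd rfl hb) hg1 hgs).2
      rw [symbOp_sD_eq] at h
      exact h.mono fun y y' => maj₂_weaken hPD' hP dD y y'
    · intro ν g hg1 hgs
      have h := (HB (s + 1) mT K r hs hK (coverCorner (MP (paramsOf d L mT K hL)) (L ^ s) (L ^ (mT - s)) (coverMargin L s) k) ν 0 g zabs (fun b hb => absurd rfl hb) hg1 hgs).2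
      rw [symbOp_sTinv_sub_one_eq] at h
      exact h.mono fun y y' => maj₂_weaken hPB' hP dB y y'
    · rw [← hwcast]
      exact mul_le_mul_of_nonneg_right key (Real.exp_nonneg _)

end Record

end Summit.QuantumFields.YangMills.BalabanUVNodes.N15.Gluing

end
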